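import Mathlib
import HarnessLib
import Literature.Analysis.FluidPDE.SelfSimilar
import Literature.Analysis.FluidPDE.SelfSimilarLiouville
import Literature.Analysis.FluidPDE.KNSSAxisymmetricNoSwirlHolds
import Literature.Analysis.FluidPDE.AxisymmetricEuler
import Literature.Analysis.FluidPDE.AxisymHouLiVariables
import Literature.Analysis.FluidPDE.NSBoundedMildOseen
import Literature.Analysis.FluidPDE.NSBoundedMildSmoothing
import Literature.Analysis.FluidPDE.NSBoundedMildOseenClassical
import Literature.Analysis.FluidPDE.KatoSymmetryCovariance
import Literature.Analysis.FluidPDE.VorticityCalculus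
import Literature.Analysis.UnboundedOperators.HeatKernel
import Literature.Analysis.FluidPDE.PineauVicolRSSChaeWolf
import Literature.Analysis.FluidPDE.AxisymGradientField
import Literature.Analysis.FluidPDE.KNSSThm53OfWindow
import Summits.NavierStokesRegularity.NavierStokesRegularity.Theorems.ThreadingFluxPoloidalLiouvillePrecessionSwirl

/-!
# Route `ThreadingFlux`, item `PoloidalLiouville` (W1, stmt-NavierStokesRegularity-1222) — crux idea «precession-gap» (ns-idea-15,
# `Cruxes/PoloidalLiouville/PrecessionSketch.lean` v2; V15 PASS-WITH-PRICE / V16, ns-wall-crit-1), RUNG F `FastPrecessionPoloidalLiouville`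
# FROM THE ONE ANALYSIS LEMMA D `ShortPeriodCollapse` — every other piece of the priced chain `FastPrecessionChainW1` discharged

Cell ns-regularity-ideate, seat ns-poloidal-K2-p2 g12 (hand for F/G per DIRECTOR-NS #264/#267/#270; `--supports` the W1 item).

`fastPrecessionPoloidalLiouville_of_shortPeriodCollapse (hD) : «F»`, where «F» is the body of `Precession.FastPrecessionPoloidalLiouville` and
`hD` the body of `Precession.ShortPeriodCollapse`, both VERBATIM up to unfolding the sketch-local definitions `IsOseenMildOn S u`
(`∀ s ∈ S, ∀ t ∈ S, s < t → ∀ x, u t x = e^{(t−s)Δ}u(s) x − B_s(u,u)(t) x`) and `IsRotatingWave x₀ Ω V v`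
(`∀ t x, v t x = R_{Ωt} V(R_{−Ωt}(x − x₀))`), which a Theorems file cannot import.  CHAIN (the sketch's, composed in the kernel):
constant `C := 2π/c₀`; `B ≤ 0` ⇒ `V ≡ 0` ⇒ `v ≡ 0` (g2′); `B > 0` ⇒ `Ω ≠ 0`, period `P = 2π/|Ω|`, `P B² ≤ c₀`; the rotating wave is
`P`-periodic on all of `ℝ`, jointly `C²` (periodic continuation of the smoothness on `t < 0`), divergence-free (weak ⇒ classical, tree
`IsWeaklyDivFree.isDivFree_of_contDiff`), bounded by `B` (`norm_rotZ`) and honest Oseen-mild on `ℝ` (time covariance `oseenDuhamel_translate`; this is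
g1 without a separate extension — `IsRotatingWave` already pins `v` on `ℝ`); D ⇒ STEADY; steady + `Ω ≠ 0` ⇒ `V` axisymmetric (g2); the profile is
unthreaded about `0` and `C¹`, hence swirl-free (E = `…PrecessionSwirl.unthreadedAxisymmetricNoSwirl`); the translate `w t x = v t (x + x₀) = V x`
(axisymmetry) is a bounded ancient mild solution (g3: `IsMildNSSolutionBetween.comp_sub_right_zero`, `IsWeaklyDivFree.comp_sub_right`), so KNSS 2009
Thm 5.2 in the tree's class (`knss_axisymmetric_no_swirl'_holds`) makes `V` a.e. constant, hence constant (g4: continuity), and `v t = R_{Ωt} b`.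

HONEST LABEL (V15/V16, director #270): a CONDITIONAL rung — D (`ShortPeriodCollapse`: an honest Oseen-mild bounded time-periodic solution with
`P‖u‖²_∞ ≤ c₀` is steady; Oseen-kernel time-Lipschitz `L¹` bound + period averaging) is carried as the explicit hypothesis and is NOT proved here;
what F decides is NON-EXISTENCE on the fast half of the precessing stratum; movement on 1222 = 0; W1 / `stub_scalarLiouville` untouched.

WHAT THIS IS NOT: not a claim about Navier–Stokes regularity; items 1222 / 27585 OPEN.
-/

noncomputable section

-- the summit and its single sub-problem share the name (CONVENTIONS §1), as in every Theorems file
set_option linter.dupNamespace false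

namespace Summit.NavierStokesRegularity.NavierStokesRegularity.Theorems.ThreadingFluxPoloidalLiouvillePrecessionFastW1

open Set Function Filter Topology Metric MeasureTheory
open scoped RealInnerProductSpace InnerProductSpace
open Literature.Analysis Literature.Analysis.FluidPDE Literature.Analysis.UnboundedOperators
open Summit.NavierStokesRegularity.NavierStokesRegularity.Theorems.ThreadingFluxPoloidalLiouvillePrecessionSwirl

/-- A rotating wave with `ΩP = ±2π` is `P`-periodic. [folklore] -/
theorem rotatingWave_periodic {v : ℝ → EuclideanSpace ℝ (Fin 3) → EuclideanSpace ℝ (Fin 3)} {x₀ : EuclideanSpace ℝ (Fin 3)} {Ω : ℝ}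
    {V : EuclideanSpace ℝ (Fin 3) → EuclideanSpace ℝ (Fin 3)} (hrw : ∀ t x, v t x = rotZ (Ω * t) (V (rotZ (-(Ω * t)) (x - x₀))))
    (hΩ : Ω ≠ 0) (t : ℝ) (x : EuclideanSpace ℝ (Fin 3)) : v (t + 2 * Real.pi / |Ω|) x = v t x := by
  rw [hrw, hrw]
  rcases lt_or_gt_of_ne hΩ with hneg | hpos
  · have e : Ω * (t + 2 * Real.pi / |Ω|) = Ω * t - 2 * Real.pi := by
      rw [abs_of_neg hneg]; field_simp; ring
    rw [e, neg_sub, show 2 * Real.pi - Ω * t = -(Ω * t) + 2 * Real.pi by ring, rotZ_sub_two_pi', rotZ_add_two_pi']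
  · have e : Ω * (t + 2 * Real.pi / |Ω|) = Ω * t + 2 * Real.pi := by
      rw [abs_of_pos hpos]; field_simp
    rw [e, neg_add, show -(Ω * t) + -(2 * Real.pi) = -(Ω * t) - 2 * Real.pi by ring, rotZ_add_two_pi', rotZ_sub_two_pi']

/-- Iterated periodicity backwards: `v (t − n P) = v t`. [folklore] -/
theorem periodic_sub_nat_mul {v : ℝ → EuclideanSpace ℝ (Fin 3) → EuclideanSpace ℝ (Fin 3)} {P : ℝ}
    (hper : ∀ t x, v (t + P) x = v t x) (n : ℕ) (t : ℝ) (x : EuclideanSpace ℝ (Fin 3)) : v (t - n * P) x = v t x := by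
  induction n with
  | zero => simp
  | succ k ih =>
    have h := hper (t - (k + 1) * P) x
    rw [show t - (k + 1 : ℕ) * P = t - (k + 1) * P by push_cast; ring]
    rw [show t - (k + 1) * P + P = t - k * P by ring] at h
    rw [← h, ih]

/-- For every `t` some whole number of periods back lies in the past `{t < 0}`. [folklore] -/
theorem exists_sub_nat_mul_neg {P : ℝ} (hP : 0 < P) (t : ℝ) : ∃ n : ℕ, t - n * P < 0 := by
  obtain ⟨n, hn⟩ := exists_nat_gt (t / P)
  refine ⟨n, ?_⟩
  have : t < n * P := by rwa [div_lt_iff₀ hP] at hn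
  linarith

/-- **RUNG F from D.**  See the module docstring. -/
theorem fastPrecessionPoloidalLiouville_of_shortPeriodCollapse
    (hD : ∃ c₀ : ℝ, 0 < c₀ ∧ ∀ (u : ℝ → EuclideanSpace ℝ (Fin 3) → EuclideanSpace ℝ (Fin 3)) (P B : ℝ), 0 < P →
      ContDiff ℝ 2 (uncurry u) → (∀ t, VectorCalculus.IsDivFree (u t)) → (∀ t x, ‖u t x‖ ≤ B) →
      (∀ s ∈ (univ : Set ℝ), ∀ t ∈ (univ : Set ℝ), s < t → ∀ x,
        u t x = heatExtension (u s) (t - s) x - oseenDuhamel 1 s u u t x) →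
      (∀ t x, u (t + P) x = u t x) → P * B ^ 2 ≤ c₀ → ∀ s t x, u s x = u t x) :
    ∃ C : ℝ, 0 < C ∧ ∀ (v : ℝ → EuclideanSpace ℝ (Fin 3) → EuclideanSpace ℝ (Fin 3)) (x₀ : EuclideanSpace ℝ (Fin 3)) (Ω B : ℝ)
      (V : EuclideanSpace ℝ (Fin 3) → EuclideanSpace ℝ (Fin 3)),
      IsBoundedAncientMildSolution 1 v → (∀ t < 0, AEStronglyMeasurable (v t) volume) →
      ContDiffOn ℝ (⊤ : ℕ∞) (uncurry v) (Iio 0 ×ˢ univ) →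
      (∀ s ∈ Iio (0 : ℝ), ∀ t ∈ Iio (0 : ℝ), s < t → ∀ x,
        v t x = heatExtension (v s) (t - s) x - oseenDuhamel 1 s v v t x) →
      (∀ t x, v t x = rotZ (Ω * t) (V (rotZ (-(Ω * t)) (x - x₀)))) → (∀ x, ‖V x‖ ≤ B) → C * B ^ 2 ≤ |Ω| →
      (∀ t < 0, ∀ x, inner ℝ (x - x₀) (curl (v t) x) = 0) →
      ∀ t < 0, ∃ b : EuclideanSpace ℝ (Fin 3), ∀ x, v t x = b := by
  obtain ⟨c₀, hc₀, hD⟩ := hD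
  refine ⟨2 * Real.pi / c₀, by positivity, ?_⟩
  intro v x₀ Ω B V hclass _hmeas hsmooth hmild hrw hVB hfast hunthr t₁ ht₁
  -- the corner `B ≤ 0`: the profile vanishes
  by_cases hB : B ≤ 0
  · have hV0 : ∀ x, V x = 0 := fun x => norm_le_zero_iff.1 ((hVB x).trans hB)
    exact ⟨0, fun x => by rw [hrw, hV0, rotZ_apply_zero_vec]⟩
  push Not at hB
  -- `Ω ≠ 0`, the period `P = 2π/|Ω|` and `P B² ≤ c₀`
  have hΩabs : 0 < |Ω| := lt_of_lt_of_le (by positivity) hfast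
  have hΩ : Ω ≠ 0 := abs_pos.1 hΩabs
  set P : ℝ := 2 * Real.pi / |Ω| with hP
  have hPpos : 0 < P := by positivity
  have hPB : P * B ^ 2 ≤ c₀ := by
    rw [hP, div_mul_eq_mul_div, div_le_iff₀ hΩabs]
    have h := mul_le_mul_of_nonneg_left hfast hc₀.le
    rw [← mul_assoc, mul_div_cancel₀ _ hc₀.ne'] at h
    linarith
  -- periodicity on all of `ℝ`
  have hper : ∀ t x, v (t + P) x = v t x := fun t x => rotatingWave_periodic hrw hΩ t x
  have hperfun : ∀ (n : ℕ) (t : ℝ), v (t - n * P) = v t := fun n t => funext fun x => periodic_sub_nat_mul hper n t x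
  -- joint smoothness on all of `ℝ × ℝ³`
  have hopen : IsOpen (Iio (0 : ℝ) ×ˢ (univ : Set (EuclideanSpace ℝ (Fin 3)))) := isOpen_Iio.prod isOpen_univ
  have hsmooth' : ContDiff ℝ (⊤ : ℕ∞) (uncurry v) := by
    rw [contDiff_iff_contDiffAt]
    rintro ⟨t, x⟩
    obtain ⟨n, hn⟩ := exists_sub_nat_mul_neg hPpos t
    have hshift : ContDiffAt ℝ (⊤ : ℕ∞) (fun p : ℝ × EuclideanSpace ℝ (Fin 3) => (p.1 - n * P, p.2)) (t, x) :=
      (contDiffAt_fst.sub contDiffAt_const).prodMk contDiffAt_snd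
    have hat : ContDiffAt ℝ (⊤ : ℕ∞) (uncurry v) (t - n * P, x) :=
      hsmooth.contDiffAt (hopen.mem_nhds (mk_mem_prod hn (mem_univ _)))
    have hcomp := hat.comp (t, x) hshift
    have e : (uncurry v) ∘ (fun p : ℝ × EuclideanSpace ℝ (Fin 3) => (p.1 - n * P, p.2)) = uncurry v := by
      funext p; simp only [comp_apply, uncurry]; rw [hperfun n p.1]
    rwa [e] at hcomp
  have hC2 : ContDiff ℝ 2 (uncurry v) := contDiff_infty.1 hsmooth' 2
  have hslice : ∀ t, ContDiff ℝ 2 (v t) := fun t =>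
    hC2.comp (contDiff_const.prodMk contDiff_id)
  -- divergence-free slices
  have hdiv : ∀ t, VectorCalculus.IsDivFree (v t) := by
    intro t
    obtain ⟨n, hn⟩ := exists_sub_nat_mul_neg hPpos t
    rw [← hperfun n t]
    exact IsWeaklyDivFree.isDivFree_of_contDiff ((hslice _).of_le one_le_two) (hclass.1.1 _ hn)
  -- the bound
  have hbdd : ∀ t x, ‖v t x‖ ≤ B := fun t x => by rw [hrw, norm_rotZ]; exact hVB _
  -- honest Oseen-mildness on all of `ℝ`
  have hmild' : ∀ s ∈ (univ : Set ℝ), ∀ t ∈ (univ : Set ℝ), s < t → ∀ x,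
      v t x = heatExtension (v s) (t - s) x - oseenDuhamel 1 s v v t x := by
    intro s _ t _ hst x
    obtain ⟨n, hn⟩ := exists_sub_nat_mul_neg hPpos t
    have hsn : s - n * P < 0 := by linarith
    have h := hmild (s - n * P) hsn (t - n * P) hn (by linarith) x
    rw [periodic_sub_nat_mul hper n t x, hperfun n s, show t - n * P - (s - n * P) = t - s by ring] at h
    rw [h]
    congr 1
    have htr := oseenDuhamel_translate 1 s (-(n * P)) v v t x
    have e : (fun τ => v (τ + -(n * P))) = v := by
      funext τ; rw [← sub_eq_add_neg]; exact hperfun n τ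
    rw [e] at htr
    rw [show s - n * P = s + -(n * P) by ring, show t - n * P = t + -(n * P) by ring, ← htr]
  -- D: the wave is STEADY
  have hsteady : ∀ s t x, v s x = v t x := hD v P B hPpos hC2 hdiv hbdd hmild' hper hPB
  -- the profile: `V y = v 0 (y + x₀)`, `C¹`, axisymmetric, unthreaded about `0`, swirl-free
  have hV : ∀ y, V y = v 0 (y + x₀) := fun y => by
    rw [hrw]; simp [rotZ_zero]
  have hVfun : V = fun y => v 0 (y + x₀) := funext hV
  have hV1 : ContDiff ℝ 1 V := by
    rw [hVfun]; exact ((hslice 0).comp (contDiff_id.add contDiff_const)).of_le one_le_two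
  have hax : IsAxisymmetric V := by
    intro θ y
    have h1 := hsteady 0 (θ / Ω) (x₀ + rotZ θ y)
    rw [hrw, hrw] at h1
    simp only [mul_zero, neg_zero, rotZ_zero, add_sub_cancel_left, mul_div_cancel₀ _ hΩ, rotZ_neg_apply_rotZ] at h1
    exact h1
  have hVd : Differentiable ℝ V := hV1.differentiable one_ne_zero
  have hcurlV : ∀ y, curl V y = curl (v 0) (y + x₀) := by
    intro y
    rw [curl_eq_curlCLM, curl_eq_curlCLM, hVfun, fderiv_comp_add_right]
  have hunV : ∀ y, inner ℝ (y - EuclideanSpace.single (2 : Fin 3) (0 : ℝ)) (curl V y) = 0 := by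
    intro y
    have h0 : EuclideanSpace.single (2 : Fin 3) (0 : ℝ) = 0 := by simp
    have hv0 : v 0 = v (-1) := funext fun x => hsteady 0 (-1) x
    rw [h0, sub_zero, hcurlV, hv0]
    have h := hunthr (-1) (by norm_num) (y + x₀)
    rwa [add_sub_cancel_right] at h
  have hswirl : HasNoSwirl V := unthreadedAxisymmetricNoSwirl V 0 hV1 hax hunV
  -- the translate `w t x = v t (x + x₀) = V x`
  have hw : ∀ t x, v t (x - -x₀) = V x := by
    intro t x
    rw [sub_neg_eq_add, hsteady t 0, hrw]
    simp only [mul_zero, neg_zero, rotZ_zero, add_sub_cancel_right]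
  have hwfun : ∀ t, (fun x => v t (x - -x₀)) = V := fun t => funext (hw t)
  have hclass' : IsBoundedAncientMildSolution 1 (fun t x => v t (x - -x₀)) := by
    refine ⟨⟨fun t ht => (hclass.1.1 t ht).comp_sub_right (-x₀), fun s t hst ht => ?_⟩, ?_⟩
    · exact (hclass.1.2 s t hst ht).comp_sub_right_zero (-x₀)
    · obtain ⟨K, hK⟩ := hclass.2
      exact ⟨K, fun t ht x => hK t ht _⟩
  have hmeas' : ∀ t < (0 : ℝ), AEStronglyMeasurable (fun x => v t (x - -x₀)) volume := fun t _ => by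
    rw [hwfun t]; exact hV1.continuous.aestronglyMeasurable
  have hax' : ∀ t < (0 : ℝ), IsAxisymmetric (fun x => v t (x - -x₀)) := fun t _ => by rw [hwfun t]; exact hax
  have hsw' : ∀ t < (0 : ℝ), HasNoSwirl (fun x => v t (x - -x₀)) := fun t _ => by rw [hwfun t]; exact hswirl
  -- KNSS 2009 Thm 5.2 in the tree's class
  obtain ⟨b, hb⟩ := knss_axisymmetric_no_swirl'_holds hclass' hmeas' hax' hsw' (-1) (by norm_num)
  rw [hwfun (-1)] at hb
  have hVb : V = fun _ => b := (hV1.continuous.ae_eq_iff_eq volume continuous_const).1 hb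
  -- conclusion
  refine ⟨rotZ (Ω * t₁) b, fun x => ?_⟩
  rw [hrw, hVb]

end Summit.NavierStokesRegularity.NavierStokesRegularity.Theorems.ThreadingFluxPoloidalLiouvillePrecessionFastW1
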